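import Summits.QuantumFields.YangMills.Theorems.UnitScaleTiltProp7CurvedLandauRowE
import HarnessLib

/-!
# Route `UnitScaleTilt`, crux K1 «MinimiserStabilityRegPr» (stmt-QuantumFields-19200), route-R E′ S3 K-form engine, ROW (P) — THE BOOKING `hDef` IN THE (eM) CURRENCY:
# the reduced true-linearisation iterate `G_k` minus the engine's covariant straight-line block functional `X` (centre frame), in `ℓ²` over the `k`-bonds, is
# `≤ 2(C_G + C_S²)·ε²·((L^k)^d)⁻¹(L^k)²·Σ_b‖Y_b‖²` from `PlaqSmall (ε(L^k)⁻²) U₀` — hence, with `Σ‖Y‖² ≤ 2M` and `ε ≤ 1`, `4N·Def ≤ 16N(C_G + C_S²)·ε·(ε·((L^k)^d)⁻¹(L^k)²·M)`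
# (at `d = 3`: `θ_Df·e·ℓ⁻¹·M`, `θ_Df := 16N(C_G + C_S²)` L-only)

Cell `ym3-torus`, width seat `ym3-torus-px5` (gen 3; ★ym-ust-19200-p1 g16 NAMER WORD 5 (iii) lists `hDef : 4N·Def ≤ θ_Df·e·ℓ⁻¹·M` («tower defect of ✓p608741 — (eM)») among the DISPLAYED
bookings of «ROW (P) KNIT»; this file is its inhabitant for GENERIC recursion families `G S` — the binders `hG0 hGs hS0 hSs` are exactly what ✓`Prop7CovConstraintSplitCoclosed`'s
`exists_reduced_family` ∕ ✓`Prop7LineIterVsEngineOfTower.exists_pureLine_family` produce, so the knit discharges `hDef` by ONE call).  THEOREMS ONLY (0 `def`, 0 `sorry`);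
`--supports stmt-QuantumFields-19200`, count-neutral.  YM₃ on T³ is a ladder rung (R3), not the Clay problem; nothing here claims a stub, the crux, d = 4 or the mass gap.

THE MATHEMATICS (bookkeeping over two landed closed forms of ★routeR-w3's ✓`Prop7CurvedLandauRowE`): `‖G_k(c) − X_c‖² ≤ 2‖G_k(c) − S_k(c)‖² + 2‖S_k(c) − X_c‖²` pointwise, then
✓`sum_normSq_reduced_sub_lineIter_le_of_tower` (`Σ‖G_k − S_k‖² ≤ C_G·ε²·((L^k)^d)⁻¹(L^k)²·Σ‖Y‖²`, `C_G = (318·d(d+2)·L^d)²(((d+2)L)²∕2)²∕4`) and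
✓`sum_normSq_lineIter_sub_engine_le_of_plaqSmall` (`Σ‖S_k − X‖² ≤ C_S²·ε²·((L^k)^d)⁻¹(L^k)²·Σ‖Y‖²`, `C_S = 2((d+2)L)³∕(L(L−1)(L²−1)) + (2(d+2)L+2d+1)²∕2`).  The (eM) reading multiplies by
`4N`, uses `Σ‖Y‖² ≤ 2M` (px12 ✓`sum_norm_sq_le_of_coclosed_split` at `Y := B`, the co-closed part) and `ε² ≤ ε` for `ε ≤ 1`; at `d = 3`, `((L^k)^3)⁻¹(L^k)² = (L^k)⁻¹ = ℓ⁻¹`.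

WHAT IS PROVED (ns `…Theorems.Prop7DefBookingEM`; any `P`, `SU(N)`, `k ≤ m + K`): `normSq_sub_le_two` (pointwise two-term), ★★ `sum_normSq_reduced_sub_engine_le_of_tower` (the `ℓ²` row
`G_k − X`), ★★ `def_booking_eM` (`4N·Def ≤ 16N(C_G+C_S²)·ε·(ε·((L^k)^d)⁻¹(L^k)²·M)`), `pow_three_inv_mul_sq` (`((L^k)^3)⁻¹(L^k)² = (L^k)⁻¹`), ★ `def_booking_eM_d3` (the d = 3 reading
`4N·Def ≤ θ_Df·ε·((L^k)⁻¹·M)·ε`-free form `≤ 16N(C_G+C_S²)·ε·(L^k)⁻¹·M` under `ε ≤ 1`).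
HONEST SCOPE.  Arithmetic over ✓`Prop7CurvedLandauRowE`; nothing of print asserted beyond the cited tree theorems; the letters `G`, `X` are the R3′ door's `hL` letters
(✓`Prop7CovFaceFluxRow.sum_normSq_centreDiff_le_of_rows`, `LINE := X`); no stub closed.

References: T. Bałaban, CMP 99 (1985) 389–434 [Balaban1985BackgroundPropagators] (Thm 3.11 p.416); CMP 95 (1984) 17–40 [Balaban1984PropagatorsI] ((1.18)–(1.20) pp.19–20);
CMP 98 (1985) 17–51 [Balaban1985Averaging] (Prop. 3 (124)–(126) p.36); CMP 102 (1985) 277–309 [Balaban1985Variational] (Prop. 7 p.299).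
-/

set_option autoImplicit false

noncomputable section

open scoped BigOperators Matrix.Norms.L2Operator Matrix

namespace Summit.QuantumFields.YangMills.Theorems.Prop7DefBookingEM

open Literature.MathematicalPhysics.QuantumFieldTheory.Balaban1983to89
open Finset T4Continuum T4ReflectionCone BlockAveraging AveragingRT ExpMeanLog BlockAveragingEMLLinearised BlockAveragingEMLLinearisedBackground
  BlockAveragingEMLProp2 B1RG242Torus
open B15DeterminingSets (embIter)
open B7Prop1Explicit (treeWord)
open B7Eq78Linearization (conjR)
open B10Eq27TorusAxialLog (holT unitsField toUField)
open Summit.QuantumFields.YangMills.Theorems.Prop7CurvedLandauRowE (sum_normSq_reduced_sub_lineIter_le_of_tower sum_normSq_lineIter_sub_engine_le_of_plaqSmall)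

variable {P : Params} {N : ℕ} [NeZero N]

/-! ## §1 Letters -/

/-- Pointwise two-term bound `‖a − c‖² ≤ 2‖a − b‖² + 2‖b − c‖²` in a normed group. [folklore] -/
theorem normSq_sub_le_two {E : Type*} [SeminormedAddCommGroup E] (a b c : E) : ‖a - c‖ ^ 2 ≤ 2 * ‖a - b‖ ^ 2 + 2 * ‖b - c‖ ^ 2 := by
  have h : ‖a - c‖ ≤ ‖a - b‖ + ‖b - c‖ := by
    have : a - c = (a - b) + (b - c) := by abel
    rw [this]; exact norm_add_le _ _
  have h0 : 0 ≤ ‖a - c‖ := norm_nonneg _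
  nlinarith [sq_nonneg (‖a - b‖ - ‖b - c‖), norm_nonneg (a - b), norm_nonneg (b - c)]

/-- `((L^k)^3)⁻¹·(L^k)² = (L^k)⁻¹` for `L^k ≠ 0` (the d = 3 reading `ℓ^{2−d} = ℓ⁻¹`). [folklore] -/
theorem pow_three_inv_mul_sq {x : ℝ} (hx : x ≠ 0) : (x ^ 3)⁻¹ * x ^ 2 = x⁻¹ := by
  field_simp

section Booking

variable {k : ℕ} (hk : k ≤ P.m + P.K) (U₀ : GaugeField P 0 (Matrix.specialUnitaryGroup (Fin N) ℂ)) (Y : PBond P 0 → Matrix (Fin N) (Fin N) ℂ)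
  (G S : (k : ℕ) → PBond P k → Matrix (Fin N) (Fin N) ℂ) (hG0 : ∀ b, G 0 b = Y b) (hS0 : ∀ b, S 0 b = Y b)
  (hGs : ∀ (k : ℕ) (c : PBond P (k + 1)), G (k + 1) c
      = (fderiv ℂ (eml : (Idx P → Matrix (Fin N) (Fin N) ℂ) → Matrix (Fin N) (Fin N) ℂ)
            (fun i => ((loopHol (Averaging.iter (fun i => blockAvg (P := P) (j := i) (expMeanLogSU (n := Fin N))) k U₀) c i :
              Matrix.specialUnitaryGroup (Fin N) ℂ) : Matrix (Fin N) (Fin N) ℂ))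
            (fun i => covWalkSum (Averaging.iter (fun i => blockAvg (P := P) (j := i) (expMeanLogSU (n := Fin N))) k U₀) (G k)
                (walk (emb c.src) (loopWord P.L c.dir (off i.1) i.2.1 i.2.2))
              * ((loopHol (Averaging.iter (fun i => blockAvg (P := P) (j := i) (expMeanLogSU (n := Fin N))) k U₀) c i :
                Matrix.specialUnitaryGroup (Fin N) ℂ) : Matrix (Fin N) (Fin N) ℂ))
            * star ((corr (expMeanLogSU (n := Fin N)) (Averaging.iter (fun i => blockAvg (P := P) (j := i) (expMeanLogSU (n := Fin N))) k U₀) c :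
                Matrix.specialUnitaryGroup (Fin N) ℂ) : Matrix (Fin N) (Fin N) ℂ)
          + ((corr (expMeanLogSU (n := Fin N)) (Averaging.iter (fun i => blockAvg (P := P) (j := i) (expMeanLogSU (n := Fin N))) k U₀) c :
                Matrix.specialUnitaryGroup (Fin N) ℂ) : Matrix (Fin N) (Fin N) ℂ)
            * covWalkSum (Averaging.iter (fun i => blockAvg (P := P) (j := i) (expMeanLogSU (n := Fin N))) k U₀) (G k)
                (walk (emb c.src) (List.replicate P.L (c.dir, true)))
            * star ((corr (expMeanLogSU (n := Fin N)) (Averaging.iter (fun i => blockAvg (P := P) (j := i) (expMeanLogSU (n := Fin N))) k U₀) c :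
                Matrix.specialUnitaryGroup (Fin N) ℂ) : Matrix (Fin N) (Fin N) ℂ))
        - ((((Fintype.card (Idx P) : ℂ))⁻¹ • ∑ i : Idx P,
              covWalkSum (Averaging.iter (fun i => blockAvg (P := P) (j := i) (expMeanLogSU (n := Fin N))) k U₀) (G k) (walk (emb c.src) (stairWord i.2.1 (off i.1))))
            - ((Averaging.iter (fun i => blockAvg (P := P) (j := i) (expMeanLogSU (n := Fin N))) (k + 1) U₀ c : Matrix.specialUnitaryGroup (Fin N) ℂ) :
                Matrix (Fin N) (Fin N) ℂ)
              * (((Fintype.card (Idx P) : ℂ))⁻¹ • ∑ i : Idx P,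
                  covWalkSum (Averaging.iter (fun i => blockAvg (P := P) (j := i) (expMeanLogSU (n := Fin N))) k U₀) (G k) (walk (emb c.tgt) (stairWord i.2.1 (off i.1))))
              * star ((Averaging.iter (fun i => blockAvg (P := P) (j := i) (expMeanLogSU (n := Fin N))) (k + 1) U₀ c :
                Matrix.specialUnitaryGroup (Fin N) ℂ) : Matrix (Fin N) (Fin N) ℂ)))
    (hSs : ∀ (k : ℕ) (c : PBond P (k + 1)), S (k + 1) c
      = ((Fintype.card (Idx P) : ℂ))⁻¹ • ∑ i : Idx P,
          ((holAt (Averaging.iter (fun i => blockAvg (P := P) (j := i) (expMeanLogSU (n := Fin N))) k U₀) (walk (emb c.src) (stairWord i.2.1 (off i.1))) :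
              Matrix.specialUnitaryGroup (Fin N) ℂ) : Matrix (Fin N) (Fin N) ℂ) *
            covWalkSum (Averaging.iter (fun i => blockAvg (P := P) (j := i) (expMeanLogSU (n := Fin N))) k U₀) (S k)
              (walk (walkEnd (emb c.src) (stairWord i.2.1 (off i.1))) (List.replicate P.L (c.dir, true))) *
          star ((holAt (Averaging.iter (fun i => blockAvg (P := P) (j := i) (expMeanLogSU (n := Fin N))) k U₀) (walk (emb c.src) (stairWord i.2.1 (off i.1))) :
              Matrix.specialUnitaryGroup (Fin N) ℂ) : Matrix (Fin N) (Fin N) ℂ))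
  {ε : ℝ} (hε : 0 < ε)
  (hε3 : (143 * ((((P.d + 4 : ℕ) : ℝ)) ^ 2 / 4) ^ 2) * ε ≤ 1 / 3)
  (hε2 : 2 * ε ≤ 2 * deltaSU (Fin N) / (((P.d + 4) * P.L : ℕ) : ℝ) ^ 2)
  (hε24 : (((P.d + 2) * P.L : ℕ) : ℝ) ^ 2 * ε ≤ 1 / 12)
  (hU : PlaqSmall (ε * (((P.L : ℝ) ^ k)⁻¹) ^ 2) U₀)

include hk hG0 hS0 hGs hSs hε hε3 hε2 hε24 hU in
/-- ★★ **`G_k − X` IN `ℓ²` ALONG THE TOWER, CLOSED FORM** — the R3′ door's `hL` letter (`LINE := X`, the engine's covariant straight-line block functional read in the centre frame):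
from `PlaqSmall (ε(L^k)⁻²) U₀`, the [B7] Prop. 2 numerals, `((d+2)L)²ε ≤ 1/12` and `159·d(d+2)³·L^{d+2}·ε ≤ 1`, for `k ≤ m + K`:
`Σ_c‖G_k(c) − X_c‖² ≤ 2(C_G + C_S²)·ε²·((L^k)^d)⁻¹(L^k)²·Σ_b‖Y_b‖²`.
[cite: Balaban1985BackgroundPropagators, Thm 3.11 p.416; Balaban1984PropagatorsI, (1.18)-(1.20) pp.19-20; Balaban1985Averaging, Prop. 3 (124)-(126) p.36] -/
theorem sum_normSq_reduced_sub_engine_le_of_tower (hεκ : 159 * P.d * ((P.d : ℝ) + 2) ^ 3 * (P.L : ℝ) ^ (P.d + 2) * ε ≤ 1) :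
    ∑ c : PBond P k, ‖G k c - (((P.L : ℂ) ^ k) ^ P.d)⁻¹ •
        (((holAt U₀ (walk (embIter k c.src) (treeWord fun _ : Fin P.d => -(((P.L ^ k - 1) / 2 : ℕ) : ℤ))) : Matrix.specialUnitaryGroup (Fin N) ℂ) :
            Matrix (Fin N) (Fin N) ℂ)
          * (∑ r : Fin P.d → Fin (P.L ^ k), ∑ s ∈ Finset.range (P.L ^ k),
              conjR (holT (unitsField (toUField U₀)) (Site.fibreSite 0 k c.src fun _ => ⟨0, pow_pos P.L_pos k⟩) (treeWord fun ν => ((r ν : ℕ) : ℤ))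
                  * holT (unitsField (toUField U₀)) (Site.fibreSite 0 k c.src r) (List.replicate s (c.dir, true)))
                (Y ⟨(fun z : Site P 0 => z.shift c.dir)^[s] (Site.fibreSite 0 k c.src r), c.dir⟩))
          * star (((holAt U₀ (walk (embIter k c.src) (treeWord fun _ : Fin P.d => -(((P.L ^ k - 1) / 2 : ℕ) : ℤ))) : Matrix.specialUnitaryGroup (Fin N) ℂ) :
              Matrix (Fin N) (Fin N) ℂ)))‖ ^ 2
      ≤ 2 * ((318 * P.d * ((P.d : ℝ) + 2) * (P.L : ℝ) ^ P.d) ^ 2 * ((((P.d + 2) * P.L : ℕ) : ℝ) ^ 2 / 2) ^ 2 / 4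
              + (2 * (((P.d + 2) * P.L : ℕ) : ℝ) ^ 3 / ((P.L : ℝ) * ((P.L : ℝ) - 1) * ((P.L : ℝ) ^ 2 - 1))
                  + ((2 * (((P.d + 2) * P.L : ℕ) : ℝ) + 2 * P.d + 1)) ^ 2 / 2) ^ 2)
          * ε ^ 2 * ((((P.L : ℝ) ^ k) ^ P.d)⁻¹ * ((P.L : ℝ) ^ k) ^ 2) * ∑ b : PBond P 0, ‖Y b‖ ^ 2 := by
  have hG := sum_normSq_reduced_sub_lineIter_le_of_tower hk U₀ Y G S hG0 hS0 hGs hSs hε hε3 hε2 hε24 hU hεκ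
  have hS := sum_normSq_lineIter_sub_engine_le_of_plaqSmall hk U₀ Y S hS0 hSs hε hε3 hε2 hε24 hU
  -- pointwise two-term split `G − X = (G − S) + (S − X)`, summed
  refine (Finset.sum_le_sum fun c _ => normSq_sub_le_two (G k c) (S k c) _).trans ?_
  rw [Finset.sum_add_distrib, ← Finset.mul_sum, ← Finset.mul_sum]
  have h2 : (0 : ℝ) ≤ 2 := by norm_num
  refine (add_le_add (mul_le_mul_of_nonneg_left hG h2) (mul_le_mul_of_nonneg_left hS h2)).trans (le_of_eq ?_)
  ring

include hk hG0 hS0 hGs hSs hε hε3 hε2 hε24 hU in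
/-- ★★ **THE BOOKING `hDef` IN THE (eM) CURRENCY** (★p1 g16 NAMER WORD 5 (iii)): with `Def := Σ_c‖G_k(c) − X_c‖²`, a mass letter `M` with `Σ_b‖Y_b‖² ≤ 2M` (the co-closed part of the
chart, px12's `Σ‖B‖² ≤ 2M`) and `ε ≤ 1`: `4N·Def ≤ 16N(C_G + C_S²)·ε·(ε·((L^k)^d)⁻¹(L^k)²·M)`, i.e. `θ_Df := 16N(C_G + C_S²)` (L-only) times `ε` times the (eM) letter
`ε·ℓ^{2−d}·M`; the extra factor `ε ≤ 1` may be dropped by the consumer.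
[cite: Balaban1985BackgroundPropagators, Thm 3.11 p.416; Balaban1984PropagatorsI, (1.18)-(1.20) pp.19-20; Balaban1985Averaging, Prop. 3 (124)-(126) p.36; Balaban1985Variational, Prop. 7 p.299] -/
theorem def_booking_eM (hεκ : 159 * P.d * ((P.d : ℝ) + 2) ^ 3 * (P.L : ℝ) ^ (P.d + 2) * ε ≤ 1) {M : ℝ} (hM : ∑ b : PBond P 0, ‖Y b‖ ^ 2 ≤ 2 * M) :
    4 * (N : ℝ) * ∑ c : PBond P k, ‖G k c - (((P.L : ℂ) ^ k) ^ P.d)⁻¹ •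
        (((holAt U₀ (walk (embIter k c.src) (treeWord fun _ : Fin P.d => -(((P.L ^ k - 1) / 2 : ℕ) : ℤ))) : Matrix.specialUnitaryGroup (Fin N) ℂ) :
            Matrix (Fin N) (Fin N) ℂ)
          * (∑ r : Fin P.d → Fin (P.L ^ k), ∑ s ∈ Finset.range (P.L ^ k),
              conjR (holT (unitsField (toUField U₀)) (Site.fibreSite 0 k c.src fun _ => ⟨0, pow_pos P.L_pos k⟩) (treeWord fun ν => ((r ν : ℕ) : ℤ))
                  * holT (unitsField (toUField U₀)) (Site.fibreSite 0 k c.src r) (List.replicate s (c.dir, true)))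
                (Y ⟨(fun z : Site P 0 => z.shift c.dir)^[s] (Site.fibreSite 0 k c.src r), c.dir⟩))
          * star (((holAt U₀ (walk (embIter k c.src) (treeWord fun _ : Fin P.d => -(((P.L ^ k - 1) / 2 : ℕ) : ℤ))) : Matrix.specialUnitaryGroup (Fin N) ℂ) :
              Matrix (Fin N) (Fin N) ℂ)))‖ ^ 2
      ≤ 16 * (N : ℝ) * ((318 * P.d * ((P.d : ℝ) + 2) * (P.L : ℝ) ^ P.d) ^ 2 * ((((P.d + 2) * P.L : ℕ) : ℝ) ^ 2 / 2) ^ 2 / 4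
              + (2 * (((P.d + 2) * P.L : ℕ) : ℝ) ^ 3 / ((P.L : ℝ) * ((P.L : ℝ) - 1) * ((P.L : ℝ) ^ 2 - 1))
                  + ((2 * (((P.d + 2) * P.L : ℕ) : ℝ) + 2 * P.d + 1)) ^ 2 / 2) ^ 2)
          * ε * (ε * ((((P.L : ℝ) ^ k) ^ P.d)⁻¹ * ((P.L : ℝ) ^ k) ^ 2) * M) := by
  have h := sum_normSq_reduced_sub_engine_le_of_tower hk U₀ Y G S hG0 hS0 hGs hSs hε hε3 hε2 hε24 hU hεκ
  set CC : ℝ := (318 * P.d * ((P.d : ℝ) + 2) * (P.L : ℝ) ^ P.d) ^ 2 * ((((P.d + 2) * P.L : ℕ) : ℝ) ^ 2 / 2) ^ 2 / 4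
              + (2 * (((P.d + 2) * P.L : ℕ) : ℝ) ^ 3 / ((P.L : ℝ) * ((P.L : ℝ) - 1) * ((P.L : ℝ) ^ 2 - 1))
                  + ((2 * (((P.d + 2) * P.L : ℕ) : ℝ) + 2 * P.d + 1)) ^ 2 / 2) ^ 2 with hCC
  set R : ℝ := (((P.L : ℝ) ^ k) ^ P.d)⁻¹ * ((P.L : ℝ) ^ k) ^ 2 with hR
  set SY : ℝ := ∑ b : PBond P 0, ‖Y b‖ ^ 2 with hSY
  have hL2 : (2 : ℝ) ≤ (P.L : ℝ) := by exact_mod_cast P.hL.2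
  have hL1 : 0 < (P.L : ℝ) - 1 := by linarith
  have hL21 : 0 < (P.L : ℝ) ^ 2 - 1 := by nlinarith
  have hCC0 : 0 ≤ CC := by positivity
  have hR0 : 0 ≤ R := by positivity
  have hN0 : (0 : ℝ) ≤ 4 * (N : ℝ) := by positivity
  refine (mul_le_mul_of_nonneg_left h hN0).trans ?_
  calc 4 * (N : ℝ) * (2 * CC * ε ^ 2 * R * SY) ≤ 4 * (N : ℝ) * (2 * CC * ε ^ 2 * R * (2 * M)) := by gcongr
    _ = 16 * (N : ℝ) * CC * ε * (ε * R * M) := by ring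

include hk hG0 hS0 hGs hSs hε hε3 hε2 hε24 hU in
/-- ★ **THE d = 3 READING** (`ℓ := L^k`, `((L^k)^3)⁻¹(L^k)² = ℓ⁻¹`, and `ε ≤ 1` dropped): at `P.d = 3`, `4N·Def ≤ 16N(C_G + C_S²)·ε·(L^k)⁻¹·M` — the NAMER's
`hDef : 4N·Def ≤ θ_Df·e·ℓ⁻¹·M` with `θ_Df := 16N(C_G + C_S²)`, `e := ε`.
[cite: Balaban1985BackgroundPropagators, Thm 3.11 p.416; Balaban1984PropagatorsI, (1.18)-(1.20) pp.19-20; Balaban1985Averaging, Prop. 3 (124)-(126) p.36; Balaban1985Variational, Prop. 7 p.299] -/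
theorem def_booking_eM_d3 (hd : P.d = 3) (hεκ : 159 * P.d * ((P.d : ℝ) + 2) ^ 3 * (P.L : ℝ) ^ (P.d + 2) * ε ≤ 1) (hε1 : ε ≤ 1)
    {M : ℝ} (hM0 : 0 ≤ M) (hM : ∑ b : PBond P 0, ‖Y b‖ ^ 2 ≤ 2 * M) :
    4 * (N : ℝ) * ∑ c : PBond P k, ‖G k c - (((P.L : ℂ) ^ k) ^ P.d)⁻¹ •
        (((holAt U₀ (walk (embIter k c.src) (treeWord fun _ : Fin P.d => -(((P.L ^ k - 1) / 2 : ℕ) : ℤ))) : Matrix.specialUnitaryGroup (Fin N) ℂ) :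
            Matrix (Fin N) (Fin N) ℂ)
          * (∑ r : Fin P.d → Fin (P.L ^ k), ∑ s ∈ Finset.range (P.L ^ k),
              conjR (holT (unitsField (toUField U₀)) (Site.fibreSite 0 k c.src fun _ => ⟨0, pow_pos P.L_pos k⟩) (treeWord fun ν => ((r ν : ℕ) : ℤ))
                  * holT (unitsField (toUField U₀)) (Site.fibreSite 0 k c.src r) (List.replicate s (c.dir, true)))
                (Y ⟨(fun z : Site P 0 => z.shift c.dir)^[s] (Site.fibreSite 0 k c.src r), c.dir⟩))
          * star (((holAt U₀ (walk (embIter k c.src) (treeWord fun _ : Fin P.d => -(((P.L ^ k - 1) / 2 : ℕ) : ℤ))) : Matrix.specialUnitaryGroup (Fin N) ℂ) :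
              Matrix (Fin N) (Fin N) ℂ)))‖ ^ 2
      ≤ 16 * (N : ℝ) * ((318 * P.d * ((P.d : ℝ) + 2) * (P.L : ℝ) ^ P.d) ^ 2 * ((((P.d + 2) * P.L : ℕ) : ℝ) ^ 2 / 2) ^ 2 / 4
              + (2 * (((P.d + 2) * P.L : ℕ) : ℝ) ^ 3 / ((P.L : ℝ) * ((P.L : ℝ) - 1) * ((P.L : ℝ) ^ 2 - 1))
                  + ((2 * (((P.d + 2) * P.L : ℕ) : ℝ) + 2 * P.d + 1)) ^ 2 / 2) ^ 2)
          * ε * ((P.L : ℝ) ^ k)⁻¹ * M := by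
  have h := def_booking_eM hk U₀ Y G S hG0 hS0 hGs hSs hε hε3 hε2 hε24 hU hεκ hM
  set CC : ℝ := (318 * P.d * ((P.d : ℝ) + 2) * (P.L : ℝ) ^ P.d) ^ 2 * ((((P.d + 2) * P.L : ℕ) : ℝ) ^ 2 / 2) ^ 2 / 4
              + (2 * (((P.d + 2) * P.L : ℕ) : ℝ) ^ 3 / ((P.L : ℝ) * ((P.L : ℝ) - 1) * ((P.L : ℝ) ^ 2 - 1))
                  + ((2 * (((P.d + 2) * P.L : ℕ) : ℝ) + 2 * P.d + 1)) ^ 2 / 2) ^ 2 with hCC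
  have hL : (0 : ℝ) < (P.L : ℝ) := by exact_mod_cast P.L_pos
  have hL2 : (2 : ℝ) ≤ (P.L : ℝ) := by exact_mod_cast P.hL.2
  have hL1 : 0 < (P.L : ℝ) - 1 := by linarith
  have hL21 : 0 < (P.L : ℝ) ^ 2 - 1 := by nlinarith
  have hCC0 : 0 ≤ CC := by positivity
  have hk0 : ((P.L : ℝ) ^ k) ≠ 0 := by positivity
  have hRd : (((P.L : ℝ) ^ k) ^ P.d)⁻¹ * ((P.L : ℝ) ^ k) ^ 2 = ((P.L : ℝ) ^ k)⁻¹ := by rw [hd]; exact pow_three_inv_mul_sq hk0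
  rw [hRd] at h
  refine h.trans ?_
  have hℓ0 : 0 ≤ ((P.L : ℝ) ^ k)⁻¹ := by positivity
  have hfac : 0 ≤ 16 * (N : ℝ) * CC * ε * (((P.L : ℝ) ^ k)⁻¹ * M) := by positivity
  calc 16 * (N : ℝ) * CC * ε * (ε * ((P.L : ℝ) ^ k)⁻¹ * M)
      = ε * (16 * (N : ℝ) * CC * ε * (((P.L : ℝ) ^ k)⁻¹ * M)) := by ring
    _ ≤ 1 * (16 * (N : ℝ) * CC * ε * (((P.L : ℝ) ^ k)⁻¹ * M)) := mul_le_mul_of_nonneg_right hε1 hfac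
    _ = 16 * (N : ℝ) * CC * ε * ((P.L : ℝ) ^ k)⁻¹ * M := by ring

end Booking

end Summit.QuantumFields.YangMills.Theorems.Prop7DefBookingEM

end
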